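import Summits.QuantumAdvantage.QuantumAdvantage.Theses.CharDial
import Summits.QuantumAdvantage.QuantumAdvantage.Theorems.CharDialTowerE
import Summits.QuantumAdvantage.QuantumAdvantage.Theorems.CharDialJLinCore
import HarnessLib

/-!
# CharDial — closer of the glue item `Res5FrobGlue` of the (α) split of `FrobHardOdd` (32598)

Cell decomp-qadv, writer g11; critic rows 67v51 (RES⁵ tower split CLEARED) / 67v52 (vehicle (α) CLEARED).
The split `FrobHardOdd ⟸ FrobStructureLawOdd ∧ JLinLowResidual5 ∧ JLinResidualHigh5` is closed BY NAME from the tree: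
the junction `charDial_frobHardOdd_of_core` (Theorems.CharDialJLinCore) re-run with the p ≥ 5 restriction of the
structure law, the reduction `charDial_walkHardFJLinOdd_iff_core`, and the tower glue `TowerDefs.closes_split`
(Theorems.CharDialTowerE).  Also recorded: the aside law 32603 gives the law child by restriction, and the necessity
anchor `WalkHardFJLinOdd` (32604) gives both tower children (`TowerDefs.split_of_closes`).
-/

namespace Summit.QuantumAdvantage.AdviceFreeQNC0.JLinPeel.TowerDefs

/-- **The glue item `Res5FrobGlue` of route CharDial holds**:
`FrobStructureLawOdd → JLinLowResidual5 → JLinResidualHigh5 → FrobHardOdd`. -/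
theorem res5FrobGlue_holds : Summit.QuantumAdvantage.QuantumAdvantage.Theses.CharDial.Res5FrobGlue := by
  intro hLaw hL hH p _ hp
  have hC := (charDial_walkHardFJLinOdd_iff_core.1 (closes_split hL hH)) p hp
  obtain ⟨J₀, hJ₀⟩ := hLaw p hp
  obtain ⟨θ, hθ, n₀, hn₀⟩ := pres_of_core p (by omega) hC
  refine ⟨θ, hθ, max n₀ (2 ^ J₀), fun n hn c y hy => hn₀ n (le_trans (le_max_left _ _) hn) c y fun g => ?_⟩
  obtain ⟨J, hJc, a, h, hdep, hrep⟩ := hJ₀ n (y g) (hy g)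
  have hd' : J₀ ≤ Nat.log 2 n := Nat.le_log_of_pow_le (by norm_num) (le_trans (le_max_right _ _) hn)
  exact ⟨J, hJc.trans hd', a, h, hdep, hrep⟩

/-- The aside `FrobStructureLaw` (32603) gives the law child `FrobStructureLawOdd` by restriction to `p ≥ 5`. -/
theorem frobStructureLawOdd_of_law (h : Summit.QuantumAdvantage.QuantumAdvantage.Theses.CharDial.FrobStructureLaw) :
    Summit.QuantumAdvantage.QuantumAdvantage.Theses.CharDial.FrobStructureLawOdd := fun p _ _ => h p

/-- Necessity anchor: `WalkHardFJLinOdd` (32604) gives both tower children of the split. -/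
theorem res5Split_of_walkHardFJLinOdd (hT : Summit.QuantumAdvantage.QuantumAdvantage.Theses.CharDial.WalkHardFJLinOdd) :
    Summit.QuantumAdvantage.QuantumAdvantage.Theses.CharDial.JLinLowResidual5 ∧
      Summit.QuantumAdvantage.QuantumAdvantage.Theses.CharDial.JLinResidualHigh5 :=
  split_of_closes hT

end Summit.QuantumAdvantage.AdviceFreeQNC0.JLinPeel.TowerDefs
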